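import Summits.QuantumFields.BalabanUV.T4Continuum.Spine.NE1p.DressedWindowSchedule
import Summits.QuantumFields.BalabanUV.T4Continuum.Spine.NE1p.DressedTransportAssembled

/-!
# T⁴ programme, spine estimate NE1′ (node O3b/H2) — END-F″: THE TRANSPORT LEAF `htr` WITH `hP` ASSEMBLED, NO BUDGET BINDER AND
# NO WINDOW GEOMETRY (swarm row S1b = F-5 ∘ F-4 of `t4/formal/NE1p/LEAVES.md` v2, DAG node N21b; ruling R-T6)

Cell `pub-balaban`, sub-cell `t4`, BINDER-OWNERS row NE1′, formalisation swarm `b2b-balaban-t4-ne1p-formalise-*`, seat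
`b2b-balaban-t4-ne1p-formalise-leaf-04` (holder of row S1 `Spine/NE1p/DressedWindowSchedule.lean`, p212498); owner lineage
t4-ne1p-p1 (skeleton `t4/skeletons/NE1p-t4-ne1p-p1.md` v1.1 §6); tree target `Summits/QuantumFields/BalabanUV/T4Continuum/Spine/NE1p/`;
ADDITIVE — imports `Spine/NE1p/DressedWindowSchedule` (row S1: the schedule and its binder discharges) and
`Spine/NE1p/DressedTransportAssembled` (row S2, leaf-01: END-F′ `transportLeaf_assembled`, p212485) ONLY; modifies nothing.

WHAT THIS FILE DOES.  END-F′ concludes the field `BookingLeaves.htr` from END-F's wall binders with `hP` REPLACED by the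
Assembly's dictionary ∕ geometry data and NO budget binder; thirteen of its binders are WINDOW GEOMETRY or RADIUS BOOKKEEPING:
`hD`, `hϱ`, `hrs_birth`, `hrs_step`, `hrs_dec`, `hϱfloor`, `hmargin`, `hN1`, `hN2`, `hN1x`, `hN2cx`, `hdiam`, `hθ`.  §1
**`transportLeaf_assembled_of_schedule`** (END-F″) reads windows, fluctuation domains, diameters, chart ∕ margin ∕ slice radii off
ONE `WindowSchedule r w` (row S1) whose chart radii stay above END-F′'s floor `r_*` (`hfloor : r_* ≤ ϱc k`), takes the reference
fluctuation in the fluctuation domain (`hz₁`), and discharges all thirteen (+ `hw`, `r_* ≤ r`) by the row-S1 lemmas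
`h*_of_schedule` BY NAME — conclusion VERBATIM the field type of `BookingLeaves.htr`.  What stays displayed is estimate ∕
dictionary content only: (w1) `hsl`, H2 `hFn`/`h𝒢`/`hQ`/`hSg`/`hs1`/`hAsz_*`, (w2-act) `hB`/`hE`, `hDμ`, (w4) `hdom`, (I4′)
`hpairx`/`hδf`/`hδfw`/`hdefw`/`hrate`, scalars `hcδ`/`hψ`/`hrstar`/`hcm`, attainment `hlin`, invariance, measurability.  §2 is
non-vacuity of the new hypothesis pair (schedule + floor): `Floored.schedule r w ρ₀` has strictly decreasing chart radii
`r/4 + r·2^{−(k+3)}` ABOVE the floor `r/4` (`Floored.floor_le`), and its windows up to step `K` are inhabited when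
`(2w + r)·K ≤ ρ₀` (`Floored.zero_mem_window`) — the linear window cost of `WindowSchedule.window_budget` again (R-slack: recorded,
not resolved).

HONEST FRAMING.  Rung (B)+1 bookkeeping on ONE finite four-torus of fixed physical size — NOT infinite volume, NOT a mass gap,
NOT OS on ℝ⁴, NOT the Clay problem, NOT summit progress.  NE1′ is NOT PRINTED and NOT PROVED; this file reads «L-T ⇐ F-1, F-2,
F-3, F-4's dictionary, F-6…F-9 + a window schedule», never «NE1′ proved».  (w2-act) `hB`/`hE` are the printed TYPE
[Balaban1989LargeFieldII] (1.65) p. 375, (1.71)–(1.75) pp. 379–380, asserted for Bałaban's densities NOWHERE; (I4′)'s rate `ψ` is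
the cell's READING (CITED-FACTS-T4 v1 §2/§4: no printed commutation identity); the schedule is a BINDER — no radius of
Bałaban's windows is asserted and whether one fits inside them along a family's history is (w3)⁺'s content.  [folklore] kernel
glue, 0 sorry, 0 citations used as facts, no `def … : Prop`.  Spine PROVED 0∕9 unchanged.  HONEST DEPENDENCY: continuum YM on
T⁴ ⇐ BetaPertH ∧ nine spine estimates (0/9 proved); BetaPertH ⇐ (D1) ∧ (D4) ∧ CAP+tail; G-an2-4 gates asym, D1 and NE2/3/4.
-/

noncomputable section

namespace Summit.QuantumFields.BalabanUV.T4Continuum.NE1p.DressedTransportScheduled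

open MeasureTheory Set Metric Finset
open scoped BigOperators
open Literature.MathematicalPhysics.QuantumFieldTheory.Balaban1983to89
open Literature.MathematicalPhysics.QuantumFieldTheory.Balaban1983to89.T4TermFormat
open Literature.MathematicalPhysics.QuantumFieldTheory.Balaban1983to89.T4GatedBooking
open Literature.MathematicalPhysics.QuantumFieldTheory.Balaban1983to89.T4TrajectoryComparison
open Literature.MathematicalPhysics.QuantumFieldTheory.Balaban1983to89.T4TrajectoryModulus
open T4BirthChartTransport (GaugeInvariant BirthSlice RelGauge)
open T4BlockTransport (Fld NDir latMove latN)
open T4TrajectoryDensity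
open Summit.QuantumFields.BalabanUV.T4Continuum.T4TrajectoryDensityDressed
open Summit.QuantumFields.BalabanUV.T4Continuum.NE1p.DressedWindowSchedule
open Summit.QuantumFields.BalabanUV.T4Continuum.NE1p.DressedTransportAssembled

/-! ## §1 END-F″: END-F′ under a window schedule with a chart-radius floor -/

section FunctionLevel

variable {r w : ℝ} (W : WindowSchedule r w)
variable {B : T4TermFormat.Booking} {T : Trajectory B}
variable {R : Type*} [NormedRing R] [NormedAlgebra ℂ R] [MeasurableSpace R] {d : ℕ}

/-- **END-F″ — THE TRANSPORT LEAF `htr` WITH `hP` ASSEMBLED UNDER THE HISTORY, NO BUDGET BINDER, AND NO WINDOW GEOMETRY**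
[bookkeeping]: leaf-01's END-F′ `DressedTransportAssembled.transportLeaf_assembled` with windows `𝒦 b k′ k := bondBall d (ρw k)`,
fluctuation domains `D b k := bondBall d (σ k)`, diameters `θ b k := 2σ k`, chart radii `ϱ b k′ k := ϱc k`, margin radii
`ϱ₁ b k := ϱ₁ k` and slice radii `rs f k″ k := sliceR W k″ k` READ OFF a `WindowSchedule r w` whose chart radii stay above the
floor `r_*` (`hfloor : r_* ≤ ϱc k`; then `r_* ≤ r` is automatic) and with the reference fluctuation in the fluctuation domain
(`hz₁`).  DISCHARGED (thirteen binders of END-F′): `hD`, `hϱ`, `hrs_birth`, `hrs_step`, `hrs_dec`, `hϱfloor`, `hmargin`, `hN1`,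
`hN2`, `hN1x`, `hN2cx`, `hdiam`, `hθ` (+ `hw`, `hrstar_r`).  DISPLAYED (estimate ∕ dictionary binders only, 0 geometry): (w1) `hsl`
births on `bondBall d (ρw k′)`; H2 `hFn`/`h𝒢` and the fresh-sum dictionary `hQ`/`hSg`/`hs1`/`hAsz_birth`/`hAsz_step`; (w2-act)
`hB`/`hE` on `bondBall d (ρw (k+1))` with chart radius `ϱc k` (printed TYPE [Balaban1989LargeFieldII] (1.65) p. 375, (1.71)–(1.75)
pp. 379–380 — asserted for Bałaban's densities NOWHERE); `hDμ` (fluctuations a.s. in `bondBall d (σ k)`); (w4) `hdom` as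
`e³·(1 + 4·(2σ k)/ϱc k) ≤ α k`; (I4′) `hpairx`/`hδf`/`hδfw`/`hdefw`/`hrate`; scalars `hcδ`/`hψ`/`hrstar`/`hcm`; attainment `hlin`;
invariance; measurability.  Conclusion: VERBATIM the field type of `BookingLeaves.htr` with `C = 4c_δ/r`, `ρ i = ψ·α i`. [folklore] -/
theorem transportLeaf_assembled_of_schedule {Fn : B.Birth → ℕ → ℕ → Fld d R → ℂ}
    {rel : B.Birth → ℕ → ℕ → Fld d R → Fld d R → Prop}
    {ref : B.Birth → ℕ → Fld d R → Fld d R} {base : B.Birth → ℕ → Fld d R → ℝ}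
    {𝒜 𝒬 : B.Birth → ℕ → Fld d R → Fld d R → ℂ} {q : B.Birth → ℕ → Fld d R → ℂ}
    {μ : B.Birth → ℕ → Measure (Fld d R)} {z₀ z₁ : B.Birth → ℕ → Fld d R}
    {defect : B.Birth → ℕ → ℕ → ℝ} {cδ ψ rstar m : ℝ} {s s1 : B.Birth → ℕ → ℝ} {α : ℕ → ℝ}
    {Asz : B.Birth → ℕ → ℕ → ℝ} {S : ℕ → B.Birth → Finset B.Birth}
    {Sg : ℕ → B.Birth → Finset (B.Birth × ℕ)} {c : B.Birth → ℕ → ℂ} {δf : B.Birth → ℕ → B.Birth × ℕ → ℝ}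
    (hα : ∀ i, 0 ≤ α i) (hr : 0 < r) (hcδ : 0 ≤ cδ) (hψ : 0 ≤ ψ)
    (hrstar : 0 < rstar) (hfloor : ∀ k, rstar ≤ W.ϱc k)
    (hsl : ∀ (b : B.Birth) (k' : ℕ), B.birthScale b ≤ k' → k' ≤ B.K →
      RanBelow (budgetGate T s m S (4 * cδ / r) (fun i => ψ * α i)) k' →
      BirthSlice (Fn b k' k') latMove latN (bondBall d (W.ρw k') : Set (Fld d R)) w r (T.gen b k'))
    (hFn : ∀ (b : B.Birth) (k' k : ℕ), B.birthScale b ≤ k' → k' ≤ k → k + 1 ≤ B.K →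
      RanBelow (budgetGate T s m S (4 * cδ / r) (fun i => ψ * α i)) (k + 1) →
      ∀ U, Fn b k' (k + 1) U =
        wOp (expWeight (base b k) (𝒜 b k + 𝒬 b k)) (μ b k) (z₀ b k) U (fun z => Fn b k' k (U + z)))
    (h𝒢 : ∀ (b : B.Birth) (k' k : ℕ), B.birthScale b ≤ k' → k' ≤ k → k + 1 ≤ B.K →
      RanBelow (budgetGate T s m S (4 * cδ / r) (fun i => ψ * α i)) (k + 1) →
      ∀ U, (fun z => Fn b k' k (U + z)) ∈ BddClass ℂ (μ b k))
    (hB : ∀ (b : B.Birth) (k' k : ℕ), B.birthScale b ≤ k' → k' ≤ k → k + 1 ≤ B.K →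
      RanBelow (budgetGate T s m S (4 * cδ / r) (fun i => ψ * α i)) (k + 1) →
      RealBaseAt (ref b k) (base b k) (𝒜 b k) (μ b k) (bondBall d (W.ρw (k + 1)) : Set (Fld d R)))
    (hE : ∀ (b : B.Birth) (k' k : ℕ), B.birthScale b ≤ k' → k' ≤ k → k + 1 ≤ B.K →
      RanBelow (budgetGate T s m S (4 * cδ / r) (fun i => ψ * α i)) (k + 1) →
      ExponentSliceAt (ref b k) (𝒜 b k) (μ b k) latMove latN (bondBall d (W.ρw (k + 1)) : Set (Fld d R)) w (W.ϱc k)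
        (s b k))
    (hQ : ∀ b k, (fun U z => 𝒬 b k U z - q b k U) =
      fun U z => c b k * ∑ p ∈ Sg k b, (Fn p.1 p.2 k (U + z) - Fn p.1 p.2 k (U + z₁ b k)))
    (hSg : ∀ k b, ∀ p ∈ Sg k b, p.1 ∈ S k b ∧ B.birthScale p.1 ≤ p.2 ∧ p.2 ≤ k)
    (hs1 : ∀ b k, s1 b k = ‖c b k‖ * ∑ p ∈ Sg k b, 4 * Asz p.1 p.2 k / W.sliceR p.2 k * δf b k p)
    (hAsz_birth : ∀ f k'', Asz f k'' k'' = T.gen f k'')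
    (hAsz_step : ∀ f k'' k, B.birthScale f ≤ k'' → k'' ≤ k →
      Asz f k'' (k + 1) = Real.exp (3 * (s f k + s1 f k)) * Asz f k'' k)
    (hcm : ∀ b k, ‖c b k‖ * r ≤ m * rstar)
    (hδf : ∀ b k, ∀ p ∈ Sg k b, 0 ≤ δf b k p ∧ δf b k p ≤ cδ * ψ ^ (k - p.2))
    (hδfw : ∀ b k, ∀ p ∈ Sg k b, δf b k p ≤ w)
    (hDμ : ∀ b k, ∀ᵐ z ∂μ b k, z ∈ (bondBall d (W.σ k) : Set (Fld d R)))
    (hz₁ : ∀ b k, z₁ b k ∈ (bondBall d (W.σ k) : Set (Fld d R)))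
    (hpairx : ∀ (b : B.Birth) (k' k : ℕ), B.birthScale b ≤ k' → k' ≤ k →
      ∀ p ∈ Sg k b, ∀ U₀ ∈ (bondBall d (W.ρw (k + 1)) : Set (Fld d R)), ∀ pd : NDir d R, 0 < latN pd → latN pd ≤ w →
        ∀ᵐ z ∂μ b k, ∀ t ∈ tube (W.ϱ₁ k / latN pd),
          RelGauge (rel p.1 p.2 k) latMove latN (latMove U₀ pd t + z₁ b k) (latMove U₀ pd t + z) (δf b k p))
    (hdom : ∀ k, k + 1 ≤ B.K → Real.exp 3 * (1 + 4 * (2 * W.σ k) / W.ϱc k) ≤ α k)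
    (hinv : ∀ b k' k, GaugeInvariant (rel b k' k) (Fn b k' k))
    (hmeas : ∀ (b f : B.Birth) (k'' k : ℕ) (U : Fld d R), AEStronglyMeasurable (fun z => Fn f k'' k (U + z)) (μ b k))
    (hdefw : ∀ b k' k, defect b k' k ≤ w)
    (hrate : ∀ (b : B.Birth) (k' k : ℕ), B.birthScale b ≤ k' → k' ≤ k → k ≤ B.K →
      defect b k' k ≤ cδ * ψ ^ (k - k'))
    (hlin : ∀ (b : B.Birth) (k' k : ℕ), B.birthScale b ≤ k' → k' ≤ k → k ≤ B.K →
      RanBelow (budgetGate T s m S (4 * cδ / r) (fun i => ψ * α i)) k → ∀ ε > 0,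
      ∃ U₀ ∈ (bondBall d (W.ρw k) : Set (Fld d R)), ∃ U₁ : Fld d R,
        RelGauge (rel b k' k) latMove latN U₀ U₁ (defect b k' k) ∧
        T.lin b k' k ≤ ‖Fn b k' k U₁ - Fn b k' k U₀‖ + ε) :
    T.TransportsFromVar (4 * cδ / r) (fun i => ψ * α i) (budgetGate T s m S (4 * cδ / r) (fun i => ψ * α i)) :=
  transportLeaf_assembled (𝒦 := fun _ _ k => (bondBall d (W.ρw k) : Set (Fld d R)))
    (D := fun _ k => (bondBall d (W.σ k) : Set (Fld d R))) (θ := fun _ k => 2 * W.σ k) (ϱ := fun _ _ k => W.ϱc k)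
    (ϱ₁ := fun _ k => W.ϱ₁ k) (rs := fun _ k'' k => W.sliceR k'' k)
    hα hr W.w_pos hcδ hψ hrstar ((hfloor 0).trans (W.ϱc_lt_r 0).le) hsl hFn h𝒢 (hD_of_schedule W) (hϱ_of_schedule W) hB hE
    hQ hSg hs1 hAsz_birth (hrs_birth_of_schedule W) hAsz_step (hrs_step_of_schedule W) (hrs_dec_of_schedule W)
    (fun _ _ k _ _ => hfloor k) (hmargin_of_schedule W Sg) hcm hδf hδfw hDμ (hN1_of_schedule W) (hN2_of_schedule W)
    (hN1x_of_schedule W Sg) (hN2cx_of_schedule W Sg hz₁) hpairx (hdiam_of_schedule W) (hθ_of_schedule W)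
    (fun _ _ k _ _ hk => hdom k hk) hinv hmeas hdefw hrate hlin

end FunctionLevel

/-! ## §2 Non-vacuity: a schedule with a chart-radius floor -/

namespace Floored

/-- **A SCHEDULE WITH A CHART-RADIUS FLOOR** [decided toy]: for every `r, w > 0` and birth window `ρ₀` — fluctuation radius
`w/2`, chart radii `r/4 + r·2^{−(k+3)}` (strictly decreasing, ABOVE the floor `r/4`), margins `r/4 + r·2^{−(k+2)}`, windows
`ρw k = ρ₀ − (2w + r)·k`.  So END-F″'s floor hypothesis `r_* ≤ ϱc k` is compatible with the strictly decreasing radii the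
Assembly's `hrs_dec` forces. [folklore] -/
def schedule (r w ρ₀ : ℝ) (hr : 0 < r) (hw : 0 < w) : WindowSchedule r w where
  ρw k := ρ₀ - (2 * w + r) * k
  σ _ := w / 2
  ϱc k := r / 4 + r / 2 ^ (k + 3)
  ϱ₁ k := r / 4 + r / 2 ^ (k + 2)
  hσ _ := by positivity
  hσw _ := by linarith
  hϱc _ := by positivity
  hϱc₁ k := by
    have h : r / 2 ^ (k + 3) < r / 2 ^ (k + 2) :=
      div_lt_div_of_pos_left hr (by positivity) (pow_lt_pow_right₀ (by norm_num) (by omega))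
    linarith
  hϱ₁r k := by
    have h : r / 2 ^ (k + 2) ≤ r / 4 :=
      div_le_div_of_nonneg_left hr.le (by norm_num) (by
        calc (4 : ℝ) = 2 ^ 2 := by norm_num
          _ ≤ 2 ^ (k + 2) := pow_le_pow_right₀ (by norm_num) (by omega))
    linarith
  hϱ₁c k := le_of_eq (by ring)
  hgap k := by
    have h : r / 2 ^ (k + 2) ≤ r / 4 :=
      div_le_div_of_nonneg_left hr.le (by norm_num) (by
        calc (4 : ℝ) = 2 ^ 2 := by norm_num
          _ ≤ 2 ^ (k + 2) := pow_le_pow_right₀ (by norm_num) (by omega))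
    push_cast
    nlinarith

/-- [decided toy] The floor: `r/4 ≤ ϱc k`. [folklore] -/
theorem floor_le (r w ρ₀ : ℝ) (hr : 0 < r) (hw : 0 < w) (k : ℕ) : r / 4 ≤ (schedule r w ρ₀ hr hw).ϱc k := by
  show r / 4 ≤ r / 4 + r / 2 ^ (k + 3)
  have : 0 ≤ r / 2 ^ (k + 3) := by positivity
  linarith

/-- [decided toy] The windows up to step `K` contain the zero background as soon as `(2w + r)·K ≤ ρ₀`. [folklore] -/
theorem zero_mem_window {R : Type*} [NormedRing R] {d : ℕ} {r w ρ₀ : ℝ} (hr : 0 < r) (hw : 0 < w) {K k : ℕ}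
    (hk : k ≤ K) (hρ₀ : (2 * w + r) * K ≤ ρ₀) :
    (0 : Fld d R) ∈ (bondBall d ((schedule r w ρ₀ hr hw).ρw k) : Set (Fld d R)) := by
  have hkK : (k : ℝ) ≤ K := by exact_mod_cast hk
  have h0 : 0 ≤ (schedule r w ρ₀ hr hw).ρw k := by
    show 0 ≤ ρ₀ - (2 * w + r) * k
    nlinarith
  intro x ν
  simpa using h0

end Floored

/-! ## §3 (v1.1) The located cost of the (schedule + floor) pair — swarm finding F-ne1pleaf08-1 (3), kernel form -/

/-- **END-F″'S HYPOTHESIS PAIR IS K-LINEAR IN THE BIRTH WINDOW** [arith] (located finding F-ne1pleaf08-1 (3) of the swarm,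
`CLAIMS.log` 2026-08-20T08:21:16Z, kernel form): a `WindowSchedule r w` whose chart radii stay above a floor `r_*` consumes MORE
than `w + r_*` of window radius per met step (in THE GAP, `ϱ₁ k > ϱc k ≥ r_*` and `σ k > 0`), so `ρw K + K·(w + r_*) ≤ ρw 0`:
with K-free `w`, `r_*` the birth window `ρw 0` — i.e. the domain demanded of the births (w1) `hsl` — grows LINEARLY with the
number of met steps of the family (and `transportLeaf_assembled`'s `hcm : ‖c b k‖·r ≤ m·r_*` ties `r_*` to the K-free budget
factor `m`).  Hence `transportLeaf_assembled_of_schedule` is correct as typed but NOT instantiable with K-free data along a family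
met at every scale of an arbitrarily long run; the re-cut removing this (per-step chart windows `wk ↓`, geometric radius floors
paid in the transport rate — swarm items R-a ∕ R-b) is NOT in this file.  Recorded, not resolved; nothing of Bałaban's windows
(B15 (1.64) p. 190: summable shrink factors — TYPE only) is asserted. [folklore] -/
theorem floor_window_budget {r w : ℝ} (W : WindowSchedule r w) {rstar : ℝ} (hfloor : ∀ k, rstar ≤ W.ϱc k) :
    ∀ K : ℕ, W.ρw K + K * (w + rstar) ≤ W.ρw 0 := by
  intro K
  induction K with
  | zero => simp
  | succ K ih =>
    have h1 := W.hgap K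
    have h2 := W.hϱc₁ K
    have h3 := hfloor K
    have h4 := W.hσ K
    push_cast
    linarith

/-- [arith] [folklore] Equivalently: a floored schedule serving `K` met steps needs a birth window of radius at least
`ρw K + K·(w + r_*)`; if the last window is inhabited (`0 ≤ ρw K`) then `K·(w + r_*) ≤ ρw 0`. -/
theorem birthWindow_ge_linear {r w : ℝ} (W : WindowSchedule r w) {rstar : ℝ} (hfloor : ∀ k, rstar ≤ W.ϱc k) {K : ℕ}
    (hK : 0 ≤ W.ρw K) : K * (w + rstar) ≤ W.ρw 0 := by
  have h := floor_window_budget W hfloor K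
  linarith

end Summit.QuantumFields.BalabanUV.T4Continuum.NE1p.DressedTransportScheduled

end
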